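import Summits.ABC.ABC.Theses.CubicResolventAllowance
import HarnessLib

/-!
# STUB-IDEAS `stub_realCubic` · ideator k1 · generation 6 — typed helper statements (rev 6)

Crux stmt-ABC-22740 `CubicResolventAllowance.IndexSzpiro`, stub `stub_realCubic` (the `0 < d_K` half),
route-ABC-CubicResolventAllowance. FAMILY 1 (recognise & import). Generation 6 adds ONE literature
match that five generations × three ideators never cited (rg of this directory: no `Dahmen`, no
`Klein form`, no `constant 2-torsion`):

**Bennett–Dahmen, *Klein forms and the generalized superelliptic equation*, Ann. of Math. 177 (2013)
171–239** [corpus:paper:doi-10-4007-annals-2013-177-1-4]. Dictionary (all items checked against the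
materialised pages):
* the stub's class `{E/ℚ : ψ₂(E) irreducible, root field ≅ K}` = `{E : E[2] ≃ E₀[2]}` = B–D's
  Frey–Hellegouarch family `E_{x,y} : Y² = X³ + 3H(x,y)X + G(x,y)` of the index form `F = F_K`
  (a "Klein form of index 2" = a nondegenerate binary cubic form), `x, y ∈ ℤ` (Prop 3.1, eq. (20),
  Thm 6.6 with `n = 2`, p.182/183/190; non-coprime `(dx', dy')` = quadratic twist by `d`);
* `Δ(E_{x,y}) = 2^{4+i}·3^{3+j}·Δ_F·F(x,y)²` (eq. (21)/(25) with `δ₂ = Δ_F = d_K`, p.180/183/185) — the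
  route's `IndexIdentity` (ideator 3, gen 2) and ideator 2's `curveOfForm` in print;
* `S_F = {p ∣ 2Δ_F} ∪ {∞} = {p ∣ 2 d_K} ∪ {∞}`; Prop 4.2 (p.186): for coprime `(x,y)` some twist
  `t ∈ {±1, ±3}` makes `E^{(t)}_{x,y}` semistable at every `p ∉ S_F` with
  `ν_p(Δ_min) = 2·ν_p(F(x,y))` — the tower law N1★ in print;
* Lemma 6.7 + Prop 4.2: a class member with good reduction outside `S_F` ⟺ a solution of the
  Thue–Mahler equation (3) `F(x,y) ∈ ℤ*_{S_F}`;
* Thm 8.4 (+ Prop 8.1/8.3, p.195–198), `n = 2`, "uses `r = 0`": constant `E[2]` on the family replaces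
  the rational isogeny of the classical modular method; output: if (3) is insoluble then
  `F(x,y) = u·z^ℓ`, `u ∈ ℤ*_{S_F}`, `gcd(x,y) = 1`, has NO solution for prime `ℓ > ℓ₀(F)`,
  `log ℓ₀ ≪ rad(2d_K)²·log rad(2d_K)` (eq. (41)) — in curve language: the `ℓ`-SYNCHRONISED tower
  profiles (`2ℓ ∣ ord_p Δ_min` for every `p ∉ S`) of the class are EMPTY for `ℓ > ℓ₀(K)` (`BD_sync`);
* Thm 9.1/1.2 (p.200, p.5): for `a² + 9a + 81` squarefree, `a, −a−9 ∉ {−4, 8, 22, 31}`, the form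
  `F_{a,3} = 3x³ − a x²y − (a+9) x y² − 3y³` has (3) insoluble; `Δ_{F_{a,3}} = (a²+9a+81)²` is a
  SQUARE (`disc_realFamily` below, kernel-checked), so these fields are cyclic, totally real: an
  infinite family INSIDE THE REAL STUB on which the hypothesis of `BD_sync` is a theorem (`BD_realFamily`).

Honest reach (verdict unchanged — the stub is open): B–D bounds the common prime EXPONENT of a fully
synchronised profile at FIXED `K`; it never bounds a DEPTH, says nothing for unsynchronised exponents,
its `ℓ₀(K)` is exponential in `rad(2d_K)²` against the stub's allowance `|d_K|¹`, and its hypothesis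
fails for all 190 classes with `|Δ_F| ≤ 1000` (p.174) — in particular for `d_K = 49, 229, 564`, the
fields of every recorded champion. What it buys: (G1) emptied slices enter the assembly for free;
(G3/G4) ideator 2's single-tower champions of depth `2k` in a B–D class have `ℓ₀(K)`-smooth `k`.
Tree cross-reference: `LevelLoweredSzpiro.SerreLevelSzpiro` (stmt-ABC-25130) states the same wall
("level lowering sees `n_p mod ℓ`, not `n_p`"); vocabulary `ModPGaloisRep.serreLevel`,
`WeierstrassCurve.IsTorsionGaloisRep`, `IsogenyGlueCongruence.TorsionSharingPrimeBound` (stmt-ABC-2157).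

Scratch namespace; not a tree proposal. `lean check`: rc 0, no `sorry` (named facts are `def … : Prop`).
-/

set_option linter.dupNamespace false

noncomputable section

namespace Summit.ABC.ABC.Cruxes.IndexSzpiro.StubIdeasRealCubic1G6

open Polynomial
open scoped NumberField
open WeierstrassCurve
open IsDedekindDomain Rat.HeightOneSpectrum

/-! ## §0 — the stub and its one-curve inequality (verbatim from rev 5) -/

/-- The stub, verbatim (payload `stub.signature`). -/
def Stub : Prop :=
  ∀ ε : ℝ, 0 < ε → ∃ C : ℝ, ∀ (W : WeierstrassCurve ℚ) [W.IsElliptic] (K : Type) [Field K]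
    [NumberField K], Irreducible W.twoTorsionPolynomial.toPoly → Module.finrank ℚ K = 3 →
    (∃ θ : K, aeval θ W.twoTorsionPolynomial.toPoly = 0) → 0 < NumberField.discr K →
    (W.minimalDiscriminantNorm ℤ : ℝ) ≤
      C * |(NumberField.discr K : ℝ)| * (W.conductorNorm ℤ : ℝ) ^ (6 + ε)

/-- The stub's inequality for one curve, one field, constants `(C, ε)`. -/
def Ineq (C ε : ℝ) (W : WeierstrassCurve ℚ) (K : Type) [Field K] [NumberField K] : Prop :=
  (W.minimalDiscriminantNorm ℤ : ℝ) ≤ C * |(NumberField.discr K : ℝ)| * (W.conductorNorm ℤ : ℝ) ^ (6 + ε)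

/-! ## §1 — the dictionary (H1–H2): class, exceptional modulus, semistability, synchronised profile -/

/-- **H1** class membership = the stub's three hypotheses on `(W, K)`: `K` is (isomorphic to) the cubic
field cut out by the irreducible 2-division polynomial of `W`; equivalently (B–D Thm 6.6, `n = 2`)
`W[2] ≃ E₀[2]` for any other member `E₀`. -/
def InClass (W : WeierstrassCurve ℚ) (K : Type) [Field K] [NumberField K] : Prop :=
  Irreducible W.twoTorsionPolynomial.toPoly ∧ Module.finrank ℚ K = 3 ∧
    ∃ θ : K, aeval θ W.twoTorsionPolynomial.toPoly = 0

/-- **H2a** the finite place `v = (p)` of `ℚ` lies OUTSIDE the exceptional modulus `s`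
(B–D's `S_F = {p ∣ 2Δ_F} ∪ {∞}` is `s = 2·|d_K|` for the index form `F = F_K`, and
`s = 2(a² + 9a + 81)` for the family `F_{a,3}` of §3). -/
def OutsideS (s : ℕ) (v : HeightOneSpectrum ℤ) : Prop :=
  ¬ natGenerator v ∣ s

/-- **H2b** semistable outside `s` (B–D Prop 4.2: inside the class this is a choice of quadratic twist
`t ∈ {±1, ±3}`; the stub is twist-normalised by ideator 1 rev 2 A2/A4 and the tree's
`SingleTowerSzpiroLine.conductorExponent_twistModel_pstar_eq_one`). -/
def SemistableOutside (s : ℕ) (W : WeierstrassCurve ℚ) : Prop :=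
  ∀ v : HeightOneSpectrum ℤ, OutsideS s v → W.conductorExponent v ≤ 1

/-- **H2c** the `ℓ`-SYNCHRONISED tower profile: every place outside `s` has `2ℓ ∣ ord_v Δ_min`.
By `Δ_min = 2^a 3^b · d_K · F_K(x,y)²` (B–D (21)/(25) + Prop 4.2 = the route's `IndexIdentity`) this says
exactly `F_K(x,y) = u·z^ℓ` with `u` an `s`-unit and `gcd(x,y) = 1` — B–D's equation (35). -/
def Sync (s ℓ : ℕ) (W : WeierstrassCurve ℚ) : Prop :=
  ∀ v : HeightOneSpectrum ℤ, OutsideS s v → 2 * ℓ ∣ W.ordMinimalDiscriminant v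

/-- **H2d** B–D's hypothesis "the Thue–Mahler equation (3) `F(x,y) ∈ ℤ*_{S_F}` is insoluble" in curve
language (Lemma 6.7 + Prop 4.2): NO member of the class of `K` has good reduction at every place
outside `s`. False for all 190 classes with `|Δ_F| ≤ 1000` (B–D p.174), in particular for
`d_K ∈ {49, 229, 564}`; true for 24 classes with `|Δ_F| ≤ 10⁴` and for the infinite family of §3. -/
def NoGoodCurveOutside (s : ℕ) (K : Type) [Field K] [NumberField K] : Prop :=
  ∀ (W : WeierstrassCurve ℚ) [W.IsElliptic], InClass W K →
    ∃ v : HeightOneSpectrum ℤ, OutsideS s v ∧ W.conductorExponent v ≠ 0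

/-- `rad n = ∏_{p ∣ n} p`. -/
def rad (n : ℕ) : ℕ := ∏ p ∈ n.primeFactors, p

/-! ## §2 — named facts from Bennett–Dahmen 2013 (H3, H3′) -/

/-- **H3 named fact `BD_sync`** (Bennett–Dahmen 2013, Thm 8.4 with Prop 8.1/8.3 for `n = 2`, applied to
the index form `F = F_K` (`Δ_F = d_K`, `S_F = {p ∣ 2d_K}`), translated by Prop 4.2, Thm 6.6 and
Lemma 6.7): if no member of the class of the cubic field `K` has good reduction outside `2d_K`, then
there is `ℓ₀ = ℓ₀(K)` such that no member semistable outside `2d_K` has an `ℓ`-synchronised tower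
profile for a prime `ℓ > ℓ₀` — case (ii)/(iii) of Thm 8.4 would produce a member of conductor
`N₁ ∈ ℤ*_{S_F}`, excluded by the hypothesis; case (i) bounds `ℓ` by (41). Unproved in the tree
(needs modularity, Ribet level lowering, Kraus/Martin dimension bounds): a NAMED FACT, used as a
hypothesis. [cite: BennettDahmen2013, Thm 8.4; Prop 4.2; Thm 6.6; Lemma 6.7] -/
def BD_sync : Prop :=
  ∀ (K : Type) [Field K] [NumberField K],
    NoGoodCurveOutside (2 * (NumberField.discr K).natAbs) K →
    ∃ ℓ₀ : ℕ, ∀ (W : WeierstrassCurve ℚ) [W.IsElliptic], InClass W K →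
      SemistableOutside (2 * (NumberField.discr K).natAbs) W →
      ∀ ℓ : ℕ, ℓ.Prime → ℓ₀ < ℓ → ¬ Sync (2 * (NumberField.discr K).natAbs) ℓ W

/-- **H3′ named fact `BD_sync_effective`**: the shape of `ℓ₀(K)` (B–D eq. (41) and the threshold
`ℓ > 163` of Prop 8.1; in the rational-newform case Prop 7.4 gives a stronger bound):
`log ℓ < c · rad(2d_K)² · log rad(2d_K)` with an absolute effective `c`. This is the K-UNIFORMITY WALL
in print: the stub allows `|d_K|¹`, the modular method pays `exp(O(rad(2d_K)² log rad(2d_K)))`.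
[cite: BennettDahmen2013, Prop 8.3 (41), Thm 8.4 (i)] -/
def BD_sync_effective : Prop :=
  ∃ c : ℝ, ∀ (K : Type) [Field K] [NumberField K],
    NoGoodCurveOutside (2 * (NumberField.discr K).natAbs) K →
    ∀ (W : WeierstrassCurve ℚ) [W.IsElliptic], InClass W K →
      SemistableOutside (2 * (NumberField.discr K).natAbs) W →
      ∀ ℓ : ℕ, ℓ.Prime → 163 < ℓ → Sync (2 * (NumberField.discr K).natAbs) ℓ W →
        Real.log ℓ < c * (rad (2 * (NumberField.discr K).natAbs) : ℝ) ^ 2 *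
          Real.log (rad (2 * (NumberField.discr K).natAbs) : ℝ)

/-! ## §3 — the real cyclic family on which the hypothesis is a theorem (H4, R1) -/

/-- **R1 (kernel-checked).** `Δ(3x³ − a x² − (a+9) x − 3) = (a² + 9a + 81)²`: a perfect square, so the
field `K_a` is cyclic, hence totally real, hence `0 < d_{K_a}` — the family sits inside the REAL stub
(and all its multiplicative towers are even: `0 < d_K ⟺ 0 < Δ_E`). -/
theorem disc_realFamily (a : ℤ) :
    (Cubic.discr ⟨3, -a, -(a + 9), -3⟩ : ℤ) = (a ^ 2 + 9 * a + 81) ^ 2 := by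
  simp only [Cubic.discr]
  ring

/-- **R1′ (kernel-checked).** `0 < a² + 9a + 81`. -/
theorem realFamily_modulus_pos (a : ℤ) : 0 < a ^ 2 + 9 * a + 81 := by
  nlinarith [sq_nonneg (2 * a + 9)]

/-- The B–D exceptional values of Thm 9.1. -/
def bdExceptional : Finset ℤ := {-4, 8, 22, 31}

/-- **H4 named fact `BD_realFamily`** (Bennett–Dahmen 2013, Thm 9.1 (p.200) translated by Prop 4.2,
Thm 6.6, Lemma 6.7 for the Klein form `F_{a,3}`, `S = {p ∣ 2(a²+9a+81)} ∪ {∞}`): for `a² + 9a + 81`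
squarefree and `a, −a−9 ∉ {−4, 8, 22, 31}`, NO elliptic curve over `ℚ` whose 2-division field is the
cyclic cubic field `K_a = ℚ(η)`, `3η³ − aη² − (a+9)η − 3 = 0`, has good reduction outside
`2(a² + 9a + 81)` — the first infinite family of Thue–Mahler equations with unbounded `S` completely
solved (Thue–Siegel/hypergeometric method, B–D §9). [cite: BennettDahmen2013, Thm 9.1, Thm 1.2] -/
def BD_realFamily : Prop :=
  ∀ a : ℤ, Squarefree (a ^ 2 + 9 * a + 81) → a ∉ bdExceptional → (-a - 9) ∉ bdExceptional →
    ∀ (K : Type) [Field K] [NumberField K], Module.finrank ℚ K = 3 →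
      (∃ η : K, aeval η (C (3 : ℚ) * X ^ 3 - C (a : ℚ) * X ^ 2 - C ((a : ℚ) + 9) * X - C (3 : ℚ)) = 0) →
      NoGoodCurveOutside (2 * (a ^ 2 + 9 * a + 81).natAbs) K

/-- **H4′ named fact `BD_realFamily_sync`** = B–D Thm 1.2 in class currency for prime exponents
(Thm 8.4 for `F_{a,3}` + Thm 9.1): on the class of `K_a` the `ℓ`-synchronised profiles outside
`2(a²+9a+81)` are empty for prime `ℓ > ℓ₀(a)`. (B–D's Thm 1.2 adds `ℓ ≥ 4` composite via
Darmon–Granville finiteness — finiteness, not emptiness, so not recorded here.)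
[cite: BennettDahmen2013, Thm 1.2, Thm 8.4, Thm 9.1] -/
def BD_realFamily_sync : Prop :=
  ∀ a : ℤ, Squarefree (a ^ 2 + 9 * a + 81) → a ∉ bdExceptional → (-a - 9) ∉ bdExceptional →
    ∀ (K : Type) [Field K] [NumberField K], Module.finrank ℚ K = 3 →
      (∃ η : K, aeval η (C (3 : ℚ) * X ^ 3 - C (a : ℚ) * X ^ 2 - C ((a : ℚ) + 9) * X - C (3 : ℚ)) = 0) →
      ∃ ℓ₀ : ℕ, ∀ (W : WeierstrassCurve ℚ) [W.IsElliptic], InClass W K →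
        SemistableOutside (2 * (a ^ 2 + 9 * a + 81).natAbs) W →
        ∀ ℓ : ℕ, ℓ.Prime → ℓ₀ < ℓ → ¬ Sync (2 * (a ^ 2 + 9 * a + 81).natAbs) ℓ W

/-! ## §4 — glue (G1–G4, all PROVED): how emptied / bounded slices enter the assembly -/

/-- **G1 (PROVED).** An emptied slice satisfies the stub inequality with ANY constant: this is the only
way B–D-type theorems (which empty sub-profiles and never bound a nonempty family) feed `Stub`. -/
theorem ineq_on_syncSlice (hBD : BD_sync) (K : Type) [Field K] [NumberField K]
    (hK : NoGoodCurveOutside (2 * (NumberField.discr K).natAbs) K) (C ε : ℝ) :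
    ∃ ℓ₀ : ℕ, ∀ (W : WeierstrassCurve ℚ) [W.IsElliptic], InClass W K →
      SemistableOutside (2 * (NumberField.discr K).natAbs) W →
      ∀ ℓ : ℕ, ℓ.Prime → ℓ₀ < ℓ → Sync (2 * (NumberField.discr K).natAbs) ℓ W → Ineq C ε W K := by
  obtain ⟨ℓ₀, h⟩ := hBD K hK
  exact ⟨ℓ₀, fun W _ hW hss ℓ hℓ hlt hsync => absurd hsync (h W hW hss ℓ hℓ hlt)⟩

/-- **G2 (PROVED).** A slice on which `Δ_min` is BOUNDED satisfies the stub inequality with `C = B`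
(`1 ≤ |d_K|` from `NumberField.discr_ne_zero`, `1 ≤ N_E` from `conductorNorm_pos_holds`): the door for
finiteness theorems (Darmon–Granville / B–D Thm 1.2 at composite `n ≥ 4`, Shafarevich). -/
theorem ineq_of_minimalDiscriminantNorm_le (B : ℕ) {C ε : ℝ} (hε : 0 < ε) (hC : (B : ℝ) ≤ C)
    (W : WeierstrassCurve ℚ) [W.IsElliptic] (K : Type) [Field K] [NumberField K]
    (hB : W.minimalDiscriminantNorm ℤ ≤ B) : Ineq C ε W K := by
  unfold Ineq
  have hC0 : 0 ≤ C := le_trans (Nat.cast_nonneg B) hC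
  have hd : (1 : ℝ) ≤ |(NumberField.discr K : ℝ)| := by
    have h1 : (1 : ℤ) ≤ |NumberField.discr K| := Int.one_le_abs (NumberField.discr_ne_zero K)
    exact_mod_cast h1
  have hN : (1 : ℝ) ≤ (W.conductorNorm ℤ : ℝ) := by
    exact_mod_cast WeierstrassCurve.conductorNorm_pos_holds W
  have hpow : (1 : ℝ) ≤ (W.conductorNorm ℤ : ℝ) ^ (6 + ε) := Real.one_le_rpow hN (by linarith)
  calc (W.minimalDiscriminantNorm ℤ : ℝ) ≤ B := by exact_mod_cast hB
    _ ≤ C := hC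
    _ = C * 1 * 1 := by ring
    _ ≤ C * |(NumberField.discr K : ℝ)| * (W.conductorNorm ℤ : ℝ) ^ (6 + ε) :=
        mul_le_mul (mul_le_mul_of_nonneg_left hd hC0) hpow zero_le_one
          (mul_nonneg hC0 (abs_nonneg _))

/-- **G3 (PROVED).** A curve whose minimal discriminant is, outside `s`, supported at ONE place `v₀` with
`2ℓ ∣ ord_{v₀} Δ_min` is `ℓ`-synchronised: ideator 2's single-tower champions of depth `2k` synchronise
at every prime `ℓ ∣ k`. -/
theorem sync_of_singleTower (s ℓ : ℕ) (W : WeierstrassCurve ℚ) (v₀ : HeightOneSpectrum ℤ)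
    (hsupp : ∀ v : HeightOneSpectrum ℤ, OutsideS s v → v ≠ v₀ → W.ordMinimalDiscriminant v = 0)
    (hdiv : 2 * ℓ ∣ W.ordMinimalDiscriminant v₀) : Sync s ℓ W := by
  intro v hv
  by_cases h : v = v₀
  · subst h; exact hdiv
  · rw [hsupp v hv h]; exact dvd_zero _

/-- **G4 (PROVED from the named fact).** In a B–D class, a single-tower member (semistable outside
`2d_K`, one bad place `v₀` outside `2d_K`) of depth `ord_{v₀} Δ_min = 2k` has `ℓ₀(K)`-SMOOTH `k`: no prime
`ℓ > ℓ₀(K)` divides `k`. (Depth itself is NOT bounded — `k = 2^m` survives — which is exactly why B–D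
does not prove the stub.) -/
theorem singleTower_halfDepth_smooth (hBD : BD_sync) (K : Type) [Field K] [NumberField K]
    (hK : NoGoodCurveOutside (2 * (NumberField.discr K).natAbs) K) :
    ∃ ℓ₀ : ℕ, ∀ (W : WeierstrassCurve ℚ) [W.IsElliptic], InClass W K →
      SemistableOutside (2 * (NumberField.discr K).natAbs) W →
      ∀ v₀ : HeightOneSpectrum ℤ,
        (∀ v : HeightOneSpectrum ℤ, OutsideS (2 * (NumberField.discr K).natAbs) v → v ≠ v₀ →
          W.ordMinimalDiscriminant v = 0) →
        ∀ ℓ : ℕ, ℓ.Prime → ℓ₀ < ℓ → ¬ 2 * ℓ ∣ W.ordMinimalDiscriminant v₀ := by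
  obtain ⟨ℓ₀, h⟩ := hBD K hK
  refine ⟨ℓ₀, fun W _ hW hss v₀ hsupp ℓ hℓ hlt hdiv => ?_⟩
  exact h W hW hss ℓ hℓ hlt (sync_of_singleTower _ ℓ W v₀ hsupp hdiv)

/-- **G5 (PROVED).** The real-family version of G1: on the class of a B–D field `K_a` the synchronised
slices are empty UNCONDITIONALLY modulo the two named facts — an infinite family of REAL cubic fields
where a nonempty piece of the stub's profile space is settled in print. -/
theorem realFamily_syncSlice_empty (h91 : BD_realFamily) (h84 : BD_realFamily → BD_realFamily_sync)
    (a : ℤ) (hsq : Squarefree (a ^ 2 + 9 * a + 81)) (ha : a ∉ bdExceptional)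
    (ha' : (-a - 9) ∉ bdExceptional) (K : Type) [Field K] [NumberField K] (hK : Module.finrank ℚ K = 3)
    (hη : ∃ η : K, aeval η (C (3 : ℚ) * X ^ 3 - C (a : ℚ) * X ^ 2 - C ((a : ℚ) + 9) * X - C (3 : ℚ)) = 0)
    (C₀ ε : ℝ) :
    ∃ ℓ₀ : ℕ, ∀ (W : WeierstrassCurve ℚ) [W.IsElliptic], InClass W K →
      SemistableOutside (2 * (a ^ 2 + 9 * a + 81).natAbs) W →
      ∀ ℓ : ℕ, ℓ.Prime → ℓ₀ < ℓ → Sync (2 * (a ^ 2 + 9 * a + 81).natAbs) ℓ W → Ineq C₀ ε W K := by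
  obtain ⟨ℓ₀, h⟩ := h84 h91 a hsq ha ha' K hK hη
  exact ⟨ℓ₀, fun W _ hW hss ℓ hℓ hlt hsync => absurd hsync (h W hW hss ℓ hℓ hlt)⟩

end Summit.ABC.ABC.Cruxes.IndexSzpiro.StubIdeasRealCubic1G6

end
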